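import Literature.RingTheory.MvPolynomial.HypersurfaceAsymptoticCases
import Literature.RingTheory.MvPolynomial.HypersurfaceFlecnodeNumerators
import Literature.Combinatorics.Extremal.LinesOnPlaneCurve
import Literature.Combinatorics.Extremal.LinesOnTwoSurfaces
import Mathlib.FieldTheory.IsAlgClosed.Basic
import Mathlib.Data.Nat.Prime.Factorial
import HarnessLib

/-!
# A low-degree surface through all lines of a non-ruled surface (Monge–Salmon–Cayley, generic form)

Topic `Literature/Combinatorics/Extremal`. Everything in this file is PROVED. The elementary,
function-field proof of the generic-point form of Kollár's Theorem 13
[Kollar2015, Thm. 13, ¶38–39] that the reduction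
`Literature.Combinatorics.Extremal.componentBound_closed_of_kollar_generic'` (with `c = 39`)
asks for:

**Theorem** (`exists_vanishing_on_lines_of_not_generically_ruled`). Let `K` be algebraically
closed, `f ∈ K[x₀,x₁,x₂]` irreducible of degree `d ≥ 3` with `char K = 0` or `d < char K`, and
suppose `{f = 0}` is NOT generically ruled (there is no `h ∉ (f)` such that every point of
`{f = 0} ∖ {h = 0}` lies on a line of the surface). Then there is `g ∉ (f)` of degree `≤ 39 d`
vanishing on every line of `{f = 0}`.

`g = ∂₂f · R(f) · R(f ∘ τ) ∘ τ`, `R` the chart flecnode polynomial of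
`HypersurfaceFlecnodeNumerators.lean` and `τ` the transposition of `x₀, x₁`. That `f ∤ R(f)`
(`not_dvd_flecRes`) is Monge's theorem at the generic point: `f ∣ R(f)` forces
`Res(T₂, T₃) = 0` in `L[σ]`, and each of the three cases of `HypersurfaceAsymptoticCases.lean`
produces a line through the generic point, which `HypersurfaceLineSpecialization.lean`
specialises to lines through all points off a proper closed subset — i.e. the surface is
generically ruled.

**Corollaries.** `card_lines_le_of_not_generically_ruled`: such a surface carries at most
`39 d²` lines (with Bézout for lines on two surfaces). The reduction of Stevens–de Zeeuw's
Theorem 4 to Kollár's Propositions 14 (2) and 55 that this theorem enables is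
`Literature.Combinatorics.Additive.stevensDeZeeuw_thm4_of_H14_H55`
(`StevensDeZeeuwOfKollarPropositions.lean`).

## References
* [Kollar2015] J. Kollár, *Szemerédi–Trotter-type theorems in dimension 3*, Adv. Math. 271
  (2015), Theorem 13, ¶38–39, §6–7.
* [StevensDeZeeuw2017] S. Stevens, F. de Zeeuw, *An improved point-line incidence bound over
  arbitrary fields*, Bull. LMS 49 (2017), Theorem 4.
-/

namespace Literature.Combinatorics.Extremal

open Polynomial MvPolynomial Literature.RingTheory.MvPolynomial
  Literature.RingTheory.MvPolynomial.Hypersurface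
open scoped Nat

section Prelim

variable {K : Type*} [Field K]

/-- `k! ≠ 0` in `K` for `k ≤ d` when `char K = 0` or `d < char K`. [folklore] -/
theorem factorial_ne_zero_of_char {d : ℕ} (hchar : ringChar K = 0 ∨ d < ringChar K) (k : ℕ)
    (hk : k ≤ d) : ((k ! : ℕ) : K) ≠ 0 := by
  intro h0
  have hdvd := ringChar.dvd h0
  rcases hchar with hc | hc
  · rw [hc, zero_dvd_iff] at hdvd
    exact (Nat.factorial_pos k).ne' hdvd
  · rcases CharP.char_is_prime_or_zero K (ringChar K) with hp | hp
    · have := (Nat.Prime.dvd_factorial hp).1 hdvd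
      omega
    · omega

/-- `n ≠ 0` in `K` for `1 ≤ n ≤ d` when `k! ≠ 0` for `k ≤ d`. [folklore] -/
theorem natCast_ne_zero_of_factorial {d : ℕ} (hfac : ∀ k, k ≤ d → ((k ! : ℕ) : K) ≠ 0) {n : ℕ}
    (h1 : 1 ≤ n) (hn : n ≤ d) : (n : K) ≠ 0 := by
  intro h0
  apply hfac n hn
  rw [← Nat.mul_factorial_pred (by omega : n ≠ 0), Nat.cast_mul, h0, zero_mul]

/-- A point-direction pair spanning a line of `{f = 0}` gives an affine line of `{f = 0}`.
[folklore] -/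
theorem exists_line_of_forall_eval_add_smul {f : MvPolynomial (Fin 3) K} (p v : Fin 3 → K)
    (hv : v ≠ 0) (h : ∀ t : K, eval (p + t • v) f = 0) :
    ∃ ℓ : AffineSubspace K (Fin 3 → K), Module.finrank K ℓ.direction = 1 ∧ p ∈ ℓ ∧
      ∀ q ∈ ℓ, eval q f = 0 := by
  refine ⟨AffineSubspace.mk' p (K ∙ v), ?_, AffineSubspace.self_mem_mk' _ _, ?_⟩
  · rw [AffineSubspace.direction_mk']
    exact finrank_span_singleton hv
  · intro q hq
    rw [AffineSubspace.mem_mk', Submodule.mem_span_singleton] at hq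
    obtain ⟨t, ht⟩ := hq
    have hq' : q = p + t • v := by
      rw [ht]
      exact (vsub_vadd q p).symm.trans (by rw [vsub_eq_sub, vadd_eq_add]; abel)
    rw [hq']
    exact h t

/-- Over an infinite field, a polynomial line of `{f = 0}` is a polynomial identity.
[folklore] -/
theorem aeval_line_eq_zero_of_forall_eval [Infinite K] {f : MvPolynomial (Fin 3) K}
    (p v : Fin 3 → K) (h : ∀ t : K, eval (p + t • v) f = 0) :
    MvPolynomial.aeval (fun i => Polynomial.C (p i) + Polynomial.C (v i) * Polynomial.X) f
      = 0 := by
  refine Polynomial.funext fun t => ?_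
  rw [eval_aeval_line, h t, Polynomial.eval_zero]

/-- A cylinder in the `x₂`-direction: if `∂₂f = 0` (and `n ≠ 0` in `K` for `n ≤ deg f`) then
`f(p + t e₂) = f(p)`. [folklore] -/
theorem eval_add_smul_single_of_pderiv_eq_zero {f : MvPolynomial (Fin 3) K}
    (hfac : ∀ k, k ≤ f.totalDegree → ((k ! : ℕ) : K) ≠ 0) (h0 : pderiv 2 f = 0)
    (p : Fin 3 → K) (t : K) :
    eval (p + t • (Pi.single 2 1 : Fin 3 → K)) f = eval p f := by
  set e₂ : Fin 3 → K := Pi.single 2 1 with he₂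
  have hder : Polynomial.derivative (MvPolynomial.aeval (fun i => Polynomial.C (p i) +
      Polynomial.C (e₂ i) * Polynomial.X) f) = 0 := by
    rw [derivative_aeval_line, Fin.sum_univ_three]
    simp [he₂, h0]
  have hconst := eq_C_of_derivative_eq_zero hder (fun n h1 hn =>
    natCast_ne_zero_of_factorial hfac h1 (hn.trans (natDegree_aeval_line_le _ _ f)))
  have h1 := eval_aeval_line p e₂ f t
  have h2 := eval_aeval_line p e₂ f 0
  rw [hconst, Polynomial.eval_C] at h1 h2
  rw [zero_smul, add_zero] at h2
  rw [← h1, h2]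

end Prelim

/-! ### From a line through the generic point to generic ruledness -/

section Generic

variable {K : Type*} [Field K] {f : MvPolynomial (Fin 3) K} [Fact (Irreducible f)]

/-- Rescaling the direction `(α, β, αp̄ + βq̄)` by `F̄ = ∂₂f̄` gives
`α V̄₀ + β V̄₁`, `V₀ = (∂₂f, 0, -∂₀f)`, `V₁ = (0, ∂₂f, -∂₁f)`. [folklore] -/
theorem aeval_line_V_of_II {L' : Type*} [CommRing L'] [Algebra K L'] [Algebra (FnField f) L']
    [IsScalarTower K (FnField f) L'] (h2 : toFn f (pderiv 2 f) ≠ 0) (α β : L')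
    (h : MvPolynomial.aeval (fun i =>
      Polynomial.C (algebraMap (FnField f) L' (toFn f (X i))) +
        Polynomial.C (![α, β, α * algebraMap (FnField f) L' (gD f 0 (toFn f (X 2))) +
          β * algebraMap (FnField f) L' (gD f 1 (toFn f (X 2)))] i) * Polynomial.X) f = 0) :
    MvPolynomial.aeval (fun i => Polynomial.C (algebraMap (FnField f) L' (toFn f (X i))) +
      Polynomial.C (α * algebraMap (FnField f) L' (toFn f (![pderiv 2 f, 0, -pderiv 0 f] i)) +
        β * algebraMap (FnField f) L' (toFn f (![0, pderiv 2 f, -pderiv 1 f] i))) *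
      Polynomial.X) f = 0 := by
  have key := aeval_line_smul_eq_zero (K := K) _ _
    (algebraMap (FnField f) L' (toFn f (pderiv 2 f))) f h
  have h02 : (0 : Fin 3) ≠ 2 := by decide
  have h12 : (1 : Fin 3) ≠ 2 := by decide
  have hp : toFn f (pderiv 2 f) * gD f 0 (toFn f (X 2)) = -toFn f (pderiv 0 f) := by
    rw [gD_X_two h2 h02]; field_simp
  have hq : toFn f (pderiv 2 f) * gD f 1 (toFn f (X 2)) = -toFn f (pderiv 1 f) := by
    rw [gD_X_two h2 h12]; field_simp
  have hpι := congrArg (algebraMap (FnField f) L') hp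
  have hqι := congrArg (algebraMap (FnField f) L') hq
  rw [map_mul, map_neg] at hpι hqι
  have hfun : (fun i => Polynomial.C (algebraMap (FnField f) L' (toFn f (X i))) +
      Polynomial.C (algebraMap (FnField f) L' (toFn f (pderiv 2 f)) *
        ![α, β, α * algebraMap (FnField f) L' (gD f 0 (toFn f (X 2))) +
          β * algebraMap (FnField f) L' (gD f 1 (toFn f (X 2)))] i) * Polynomial.X) =
      fun i => Polynomial.C (algebraMap (FnField f) L' (toFn f (X i))) +
        Polynomial.C (α * algebraMap (FnField f) L' (toFn f (![pderiv 2 f, 0, -pderiv 0 f] i))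
          + β * algebraMap (FnField f) L' (toFn f (![0, pderiv 2 f, -pderiv 1 f] i))) *
        Polynomial.X := by
    funext i
    have hs : algebraMap (FnField f) L' (toFn f (pderiv 2 f)) *
        ![α, β, α * algebraMap (FnField f) L' (gD f 0 (toFn f (X 2))) +
          β * algebraMap (FnField f) L' (gD f 1 (toFn f (X 2)))] i =
        α * algebraMap (FnField f) L' (toFn f (![pderiv 2 f, 0, -pderiv 0 f] i)) +
          β * algebraMap (FnField f) L' (toFn f (![0, pderiv 2 f, -pderiv 1 f] i)) := by
      match i with
      | 0 =>
        simp only [Matrix.cons_val_zero, map_zero, mul_zero, add_zero]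
        ring
      | 1 =>
        simp only [Matrix.cons_val_one, Matrix.cons_val_zero, map_zero, mul_zero, zero_add]
        ring
      | 2 =>
        simp only [Matrix.cons_val, map_neg]
        linear_combination α * hpι + β * hqι
    rw [hs]
  rw [← hfun]
  exact key

/-- Base change of a polynomial line identity along `L → L''`. [folklore] -/
theorem aeval_line_map_algebraMap {L'' : Type*} [CommRing L''] [Algebra K L'']
    [Algebra (FnField f) L''] [IsScalarTower K (FnField f) L''] (a w : Fin 3 → FnField f)
    (h : MvPolynomial.aeval (fun i => Polynomial.C (a i) + Polynomial.C (w i) * Polynomial.X) f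
      = 0) :
    MvPolynomial.aeval (fun i => Polynomial.C (algebraMap (FnField f) L'' (a i)) +
      Polynomial.C (algebraMap (FnField f) L'' (w i)) * Polynomial.X) f = 0 := by
  have key := ringHom_mvPolynomial_aeval (K := K) (mapRingHom (algebraMap (FnField f) L''))
    (fun c => by
      rw [Polynomial.algebraMap_apply, Polynomial.algebraMap_apply, coe_mapRingHom,
        Polynomial.map_C, ← IsScalarTower.algebraMap_apply])
    (fun i => Polynomial.C (a i) + Polynomial.C (w i) * Polynomial.X) f
  rw [h, map_zero] at key
  have hfun : (fun i => mapRingHom (algebraMap (FnField f) L'')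
      (Polynomial.C (a i) + Polynomial.C (w i) * Polynomial.X)) =
      fun i => Polynomial.C (algebraMap (FnField f) L'' (a i)) +
        Polynomial.C (algebraMap (FnField f) L'' (w i)) * Polynomial.X := by
    funext i
    rw [coe_mapRingHom, Polynomial.map_add, Polynomial.map_mul, Polynomial.map_C,
      Polynomial.map_C, Polynomial.map_X]
  rw [← hfun]
  exact key.symm

/-- `root (X - C a) = a`. [folklore] -/
theorem adjoinRoot_root_X_sub_C {L : Type*} [CommRing L] (a : L) :
    AdjoinRoot.root (Polynomial.X - Polynomial.C a) = AdjoinRoot.of _ a := by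
  have h := (AdjoinRoot.mk_self : AdjoinRoot.mk (Polynomial.X - Polynomial.C a)
    (Polynomial.X - Polynomial.C a) = 0)
  rw [map_sub, AdjoinRoot.mk_X, AdjoinRoot.mk_C] at h
  exact sub_eq_zero.1 h

/-- The leading coefficient of `T₂` is `t = D₁D₁z̄`. [folklore] -/
theorem coeff_osc_two (h2 : toFn f (pderiv 2 f) ≠ 0) :
    (osc f 2).coeff 2 = gD f 1 (gD f 1 (toFn f (X 2))) := by
  rw [osc_two h2, Polynomial.coeff_add, Polynomial.coeff_add, Polynomial.coeff_C,
    if_neg (by norm_num), Polynomial.coeff_C_mul_X, if_neg (by norm_num),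
    Polynomial.coeff_C_mul_X_pow, if_pos rfl, zero_add, zero_add]

end Generic

/-! ### Monge's theorem at the generic point: `f ∤ R(f)` unless the surface is generically ruled -/

section Monge

variable {K : Type*} [Field K] [IsAlgClosed K]

/-- **Monge–Salmon at the generic point.** Let `f` be irreducible of degree `d ≥ 3` with
`k! ≠ 0` in `K` for `k ≤ d`, and suppose `{f = 0}` is not generically ruled. Then `∂₂f ≠ 0`
and `f ∤ R(f)`. (If `f ∣ R(f)` then `Res(T₂, T₃) = 0` over `L = Frac(K[x]/(f))`; the three
cases `t = 0` / developable / flecnodal of `HypersurfaceAsymptoticCases` each give a line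
through the generic point, which specialises (`exists_line_through_of_generic_line`) to a line
of the surface through every point off a proper closed subset.)
[cite: Kollar2015, ¶38–39 and Theorem 13 (Monge–Salmon–Cayley)] -/
theorem pderiv_ne_zero_and_not_dvd_flecRes {f : MvPolynomial (Fin 3) K} (hf : Irreducible f)
    (hd : 3 ≤ f.totalDegree) (hfac : ∀ k, k ≤ f.totalDegree → ((k ! : ℕ) : K) ≠ 0)
    (hngr : ¬ ∃ h : MvPolynomial (Fin 3) K, ¬ f ∣ h ∧ ∀ p : Fin 3 → K, eval p f = 0 →
      eval p h ≠ 0 → ∃ ℓ : AffineSubspace K (Fin 3 → K), Module.finrank K ℓ.direction = 1 ∧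
        p ∈ ℓ ∧ ∀ q ∈ ℓ, eval q f = 0) :
    pderiv 2 f ≠ 0 ∧ ¬ f ∣ flecRes f := by
  haveI : Fact (Irreducible f) := ⟨hf⟩
  haveI : Infinite K := IsAlgClosed.instInfinite
  -- `∂₂f ≠ 0`: otherwise the surface is a cylinder, ruled by vertical lines
  have hF : pderiv 2 f ≠ 0 := by
    intro h0
    refine hngr ⟨1, fun h1 => hf.not_isUnit (isUnit_of_dvd_one h1), fun p hp _ => ?_⟩
    refine exists_line_of_forall_eval_add_smul p (Pi.single 2 1) (by simp) fun t => ?_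
    rw [eval_add_smul_single_of_pderiv_eq_zero hfac h0, hp]
  refine ⟨hF, fun hdvd => ?_⟩
  have h2 : toFn f (pderiv 2 f) ≠ 0 := toFn_pderiv_ne_zero f hF
  have h2K : (2 : K) ≠ 0 := by
    exact_mod_cast natCast_ne_zero_of_factorial hfac (by norm_num : 1 ≤ 2) (by omega)
  -- from a generic line (Step C output) to generic ruledness: the common final step
  have finish : ∀ (V₀ V₁ : Fin 3 → MvPolynomial (Fin 3) K) (j : Fin 3), V₀ j = pderiv 2 f →
      V₁ j = 0 → (∃ b : MvPolynomial (Fin 3) K, ¬ f ∣ b ∧ ∀ p : Fin 3 → K, eval p f = 0 →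
        eval p b ≠ 0 → ∃ s₀ : K, ∀ t : K,
          eval (p + t • fun i => eval p (V₀ i) + s₀ * eval p (V₁ i)) f = 0) → False := by
    rintro V₀ V₁ j hj0 hj1 ⟨b, hfb, hb⟩
    refine hngr ⟨b * pderiv 2 f, fun hdvd' => ?_, fun p hp hbp => ?_⟩
    · rcases hf.prime.dvd_or_dvd hdvd' with h | h
      · exact hfb h
      · exact h2 ((toFn_eq_zero_iff f).2 h)
    · rw [map_mul] at hbp
      obtain ⟨s₀, hs₀⟩ := hb p hp (left_ne_zero_of_mul hbp)
      refine exists_line_of_forall_eval_add_smul p _ (fun hv => right_ne_zero_of_mul hbp ?_) hs₀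
      have := congrFun hv j
      rwa [Pi.zero_apply, hj0, hj1, map_zero, mul_zero, add_zero] at this
  -- `Res(T₂, T₃) = 0` over `L`
  have hres : resultant (osc f 2) (osc f 3) 2 3 = 0 := by
    have h := resultant_map_map (num₂ f) (num₃ f) 2 3
      (toFn f : MvPolynomial (Fin 3) K →+* FnField f)
    rw [map_num₂ f h2, map_num₃ f h2, resultant_C_mul_left, resultant_C_mul_right,
      RingHom.coe_coe, (show toFn f (resultant (num₂ f) (num₃ f) 2 3) = 0 from
        (toFn_eq_zero_iff f).2 hdvd)] at h
    rcases mul_eq_zero.1 h with h' | h'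
    · exact absurd h' (pow_ne_zero _ (pow_ne_zero _ h2))
    · rcases mul_eq_zero.1 h' with h'' | h''
      · exact absurd h'' (pow_ne_zero _ (pow_ne_zero _ h2))
      · exact h''
  -- the direction polynomials `V₀ = (F, 0, -f₀)`, `V₁ = (0, F, -f₁)`
  set V₀ : Fin 3 → MvPolynomial (Fin 3) K := ![pderiv 2 f, 0, -pderiv 0 f] with hV₀
  set V₁ : Fin 3 → MvPolynomial (Fin 3) K := ![0, pderiv 2 f, -pderiv 1 f] with hV₁
  by_cases ht : gD f 1 (gD f 1 (toFn f (X 2))) = 0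
  · -- Case 1: `t = 0`, the line with direction `V₁`
    have hgen := aeval_line_eq_zero_of_t_eq_zero h2 hfac ht
    have hE1 : MvPolynomial.aeval (fun i =>
        Polynomial.C (algebraMap (FnField f) (FnField f) (toFn f (X i))) +
        Polynomial.C (![(0 : FnField f), 1,
          0 * algebraMap (FnField f) (FnField f) (gD f 0 (toFn f (X 2))) +
          1 * algebraMap (FnField f) (FnField f) (gD f 1 (toFn f (X 2)))] i) * Polynomial.X)
        f = 0 := by
      simpa only [Algebra.algebraMap_self, RingHom.id_apply, zero_mul, one_mul, zero_add]
        using hgen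
    have hV := aeval_line_V_of_II h2 (0 : FnField f) 1 hE1
    simp only [Algebra.algebraMap_self, RingHom.id_apply, zero_mul, one_mul, zero_add] at hV
    have hT := aeval_line_map_algebraMap (L'' := AdjoinRoot (Polynomial.X : Polynomial (FnField f)))
      _ _ hV
    refine finish V₁ 0 1 (by simp [hV₁]) rfl (exists_line_through_of_generic_line f
      Polynomial.X (by rw [Polynomial.natDegree_X]; exact one_ne_zero) V₁ 0 ?_)
    convert hT using 3
    funext i
    simp only [Pi.zero_apply, map_zero, mul_zero, add_zero, hV₁]
  · by_cases hdisc : gD f 1 (gD f 0 (toFn f (X 2))) ^ 2 -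
        gD f 0 (gD f 0 (toFn f (X 2))) * gD f 1 (gD f 1 (toFn f (X 2))) = 0
    · -- Case 2: developable, the line with direction `V₀ + σ₀ V₁`, `σ₀ = -s/t`
      set σ₀ : FnField f := -gD f 1 (gD f 0 (toFn f (X 2))) / gD f 1 (gD f 1 (toFn f (X 2)))
        with hσ₀
      have hσ : σ₀ * gD f 1 (gD f 1 (toFn f (X 2))) = -gD f 1 (gD f 0 (toFn f (X 2))) := by
        rw [hσ₀]; field_simp
      have hgen := aeval_line_eq_zero_of_developable h2 hfac ht hdisc σ₀ hσ
      have hE1 : MvPolynomial.aeval (fun i =>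
          Polynomial.C (algebraMap (FnField f) (FnField f) (toFn f (X i))) +
          Polynomial.C (![(1 : FnField f), σ₀,
            1 * algebraMap (FnField f) (FnField f) (gD f 0 (toFn f (X 2))) +
            σ₀ * algebraMap (FnField f) (FnField f) (gD f 1 (toFn f (X 2)))] i) * Polynomial.X)
          f = 0 := by
        simpa only [Algebra.algebraMap_self, RingHom.id_apply, one_mul] using hgen
      have hV := aeval_line_V_of_II h2 (1 : FnField f) σ₀ hE1
      simp only [Algebra.algebraMap_self, RingHom.id_apply, one_mul] at hV
      have hT := aeval_line_map_algebraMap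
        (L'' := AdjoinRoot (Polynomial.X - Polynomial.C σ₀ : Polynomial (FnField f))) _ _ hV
      refine finish V₀ V₁ 0 (by simp [hV₀]) (by simp [hV₁])
        (exists_line_through_of_generic_line f (Polynomial.X - Polynomial.C σ₀)
          (by rw [Polynomial.natDegree_X_sub_C]; exact one_ne_zero) V₀ V₁ ?_)
      convert hT using 3
      funext i
      simp only [AdjoinRoot.algebraMap_eq, map_add, map_mul, adjoinRoot_root_X_sub_C, hV₀, hV₁]
    · -- Case 3: flecnodal slope
      have h22 : (osc f 2).natDegree = 2 := by
        refine le_antisymm (natDegree_osc_le f 2) (Polynomial.le_natDegree_of_ne_zero ?_)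
        rw [coeff_osc_two h2]; exact ht
      have hres' : resultant (osc f 2) (osc f 3) 2 (osc f 3).natDegree = 0 := by
        have h3 := natDegree_osc_le f 3
        have key := resultant_add_right_deg (osc f 2) (osc f 3) 2 (osc f 3).natDegree
          (3 - (osc f 3).natDegree) le_rfl
        rw [(show (osc f 3).natDegree + (3 - (osc f 3).natDegree) = 3 by omega), hres,
          coeff_osc_two h2] at key
        exact (mul_eq_zero.1 key.symm).resolve_left (pow_ne_zero _ ht)
      have hres'' : resultant (osc f 2) (osc f 3) = 0 := by
        rw [(show resultant (osc f 2) (osc f 3) =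
          resultant (osc f 2) (osc f 3) (osc f 2).natDegree (osc f 3).natDegree from rfl), h22]
        exact hres'
      have hcop : ¬ IsCoprime (osc f 2) (osc f 3) := (resultant_eq_zero_iff.1 hres'').2
      obtain ⟨q, hq0, hgen⟩ := exists_flecnodal_line h2 hfac h2K ht hdisc hcop
      have hV := aeval_line_V_of_II h2 (1 : AdjoinRoot q) (AdjoinRoot.root q) hgen
      refine finish V₀ V₁ 0 (by simp [hV₀]) (by simp [hV₁])
        (exists_line_through_of_generic_line f q hq0 V₀ V₁ ?_)
      convert hV using 3
      funext i
      rw [one_mul]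

end Monge

/-! ### Assembly: the polynomial `∂₂f · R(f) · R(f∘τ)∘τ` -/

section Assembly

variable {K : Type*} [Field K]

/-- Generic ruledness is invariant under an involutive permutation of the coordinates.
[folklore] -/
theorem genericallyRuled_of_rename {f : MvPolynomial (Fin 3) K} (e : Fin 3 ≃ Fin 3)
    (he : ∀ i, e (e i) = i)
    (h : ∃ h' : MvPolynomial (Fin 3) K, ¬ rename e f ∣ h' ∧ ∀ p : Fin 3 → K,
      eval p (rename e f) = 0 → eval p h' ≠ 0 → ∃ ℓ : AffineSubspace K (Fin 3 → K),
        Module.finrank K ℓ.direction = 1 ∧ p ∈ ℓ ∧ ∀ q ∈ ℓ, eval q (rename e f) = 0) :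
    ∃ h : MvPolynomial (Fin 3) K, ¬ f ∣ h ∧ ∀ p : Fin 3 → K, eval p f = 0 →
      eval p h ≠ 0 → ∃ ℓ : AffineSubspace K (Fin 3 → K), Module.finrank K ℓ.direction = 1 ∧
        p ∈ ℓ ∧ ∀ q ∈ ℓ, eval q f = 0 := by
  have hee' : ((e : Fin 3 → Fin 3) ∘ e) = id := funext he
  have hee : ∀ g : MvPolynomial (Fin 3) K, rename e (rename e g) = g := fun g => by
    rw [rename_rename, hee', rename_id]; rfl
  have hpe : ∀ p : Fin 3 → K, (p ∘ e) ∘ e = p := fun p => funext fun i => by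
    simp only [Function.comp_apply, he]
  obtain ⟨h', hnd, hh'⟩ := h
  refine ⟨rename e h', fun hd => hnd ?_, fun p hp hph => ?_⟩
  · have := map_dvd (rename e) hd
    rwa [hee] at this
  · have hp' : eval (p ∘ e) (rename e f) = 0 := by rw [eval_rename, hpe, hp]
    have hh'p : eval (p ∘ e) h' ≠ 0 := by rwa [← hee h', eval_rename, hpe]
    obtain ⟨ℓ', hℓ', hpℓ', hℓ'f⟩ := hh' _ hp' hh'p
    obtain ⟨⟨u, w⟩, hw, hmem, -⟩ := exists_point_dir_of_finrank_eq_one ℓ' hℓ'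
    obtain ⟨t₀, ht₀⟩ := (hmem _).1 hpℓ'
    refine exists_line_of_forall_eval_add_smul p (w ∘ e) (fun hw0 => hw ?_) fun t => ?_
    · funext i
      have := congrFun hw0 (e i)
      simpa only [Function.comp_apply, he, Pi.zero_apply] using this
    · have hmem' : (p ∘ e) + t • w ∈ ℓ' := (hmem _).2 ⟨t₀ + t, by rw [ht₀, add_smul, add_assoc]⟩
      have := hℓ'f _ hmem'
      rw [eval_rename] at this
      convert this using 3
      funext i
      simp only [Function.comp_apply, Pi.add_apply, Pi.smul_apply, he]

/-- **A surface of degree `≤ 39 d` through all lines of a non-ruled surface**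
(Monge–Salmon–Cayley / Kollár's Theorem 13 at the generic point, elementary form). Let `K` be
algebraically closed and `f ∈ K[x₀,x₁,x₂]` irreducible of degree `d ≥ 3` with `char K = 0` or
`d < char K`. If `{f = 0}` is not generically ruled, there is `g ∉ (f)` with `deg g ≤ 39 d`
vanishing on every line contained in `{f = 0}`: `g = ∂₂f · R(f) · R(f∘τ)∘τ` with `R` the chart
flecnode polynomial and `τ = (x₀ x₁)`.
[cite: Kollar2015, Theorem 13 and ¶38–39 (with the degree `11d - 24` of Salmon's flecnodal
polynomial replaced by the elementary `39 d`)] -/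
theorem exists_vanishing_on_lines_of_not_generically_ruled [IsAlgClosed K]
    {f : MvPolynomial (Fin 3) K} (hf : Irreducible f) (hd : 3 ≤ f.totalDegree)
    (hchar : ringChar K = 0 ∨ f.totalDegree < ringChar K)
    (hngr : ¬ ∃ h : MvPolynomial (Fin 3) K, ¬ f ∣ h ∧ ∀ p : Fin 3 → K, eval p f = 0 →
      eval p h ≠ 0 → ∃ ℓ : AffineSubspace K (Fin 3 → K), Module.finrank K ℓ.direction = 1 ∧
        p ∈ ℓ ∧ ∀ q ∈ ℓ, eval q f = 0) :
    ∃ g : MvPolynomial (Fin 3) K, ¬ f ∣ g ∧ g.totalDegree ≤ 39 * f.totalDegree ∧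
      ∀ ℓ : AffineSubspace K (Fin 3 → K), Module.finrank K ℓ.direction = 1 →
        (∀ q ∈ ℓ, eval q f = 0) → ∀ q ∈ ℓ, eval q g = 0 := by
  haveI : Fact (Irreducible f) := ⟨hf⟩
  haveI : Infinite K := IsAlgClosed.instInfinite
  have hfac : ∀ k, k ≤ f.totalDegree → ((k ! : ℕ) : K) ≠ 0 := factorial_ne_zero_of_char hchar
  -- the transposition `τ = (x₀ x₁)` and `f' = f ∘ τ`
  set e : Fin 3 ≃ Fin 3 := Equiv.swap 0 1 with he_def
  have he : ∀ i, e (e i) = i := fun i => Equiv.swap_apply_self _ _ _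
  have hee' : ((e : Fin 3 → Fin 3) ∘ e) = id := funext he
  have hee : ∀ g : MvPolynomial (Fin 3) K, rename e (rename e g) = g := fun g => by
    rw [rename_rename, hee', rename_id]; rfl
  have hdeg' : (rename e f).totalDegree = f.totalDegree := by
    refine le_antisymm (totalDegree_rename_le _ _) ?_
    conv_lhs => rw [← hee f]
    exact totalDegree_rename_le _ _
  have hf' : Irreducible (rename e f) :=
    (MulEquiv.irreducible_iff (renameEquiv K e).toMulEquiv).2 hf
  have hngr' := fun h => hngr (genericallyRuled_of_rename e he h)
  obtain ⟨hF, hR⟩ := pderiv_ne_zero_and_not_dvd_flecRes hf hd hfac hngr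
  obtain ⟨-, hR'⟩ := pderiv_ne_zero_and_not_dvd_flecRes hf' (by rw [hdeg']; exact hd)
    (by rw [hdeg']; exact hfac) hngr'
  refine ⟨pderiv 2 f * (flecRes f * rename e (flecRes (rename e f))), fun hdvd => ?_, ?_, ?_⟩
  · -- `f ∤ g`
    rcases hf.prime.dvd_or_dvd hdvd with h | h
    · exact toFn_pderiv_ne_zero f hF ((toFn_eq_zero_iff f).2 h)
    · rcases hf.prime.dvd_or_dvd h with h' | h'
      · exact hR h'
      · have := map_dvd (rename e) h'
        rw [hee] at this
        exact hR' this
  · -- `deg g ≤ 39 d`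
    refine (totalDegree_mul _ _).trans ?_
    have h1 := Ruppert.totalDegree_pderiv_le 2 f
    have h2 := totalDegree_flecRes_le f
    have h3 := (totalDegree_rename_le e _).trans (totalDegree_flecRes_le (rename e f))
    rw [hdeg'] at h3
    have h4 := (totalDegree_mul (flecRes f) (rename e (flecRes (rename e f)))).trans
      (Nat.add_le_add h2 h3)
    omega
  · -- `g` vanishes on every line of the surface
    intro ℓ hℓ hℓf q hq
    obtain ⟨⟨u, w⟩, hw, hmem, -⟩ := exists_point_dir_of_finrank_eq_one ℓ hℓ
    obtain ⟨t₀, ht₀⟩ := (hmem q).1 hq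
    have hline : ∀ t : K, eval (q + t • w) f = 0 := fun t =>
      hℓf _ ((hmem _).2 ⟨t₀ + t, by rw [ht₀, add_smul, add_assoc]⟩)
    have hpoly := aeval_line_eq_zero_of_forall_eval q w hline
    rw [map_mul, map_mul]
    by_cases hw0 : w 0 = 0
    · by_cases hw1 : w 1 = 0
      · -- vertical line: `∂₂f` vanishes along it
        have hw2 : w 2 ≠ 0 := by
          intro hw2; apply hw; funext i
          match i with
          | 0 => exact hw0
          | 1 => exact hw1
          | 2 => exact hw2
        have hder := derivative_aeval_line q w f
        rw [hpoly, derivative_zero, Fin.sum_univ_three, hw0, hw1, Polynomial.C_0, zero_mul,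
          zero_mul, zero_add, zero_add, eq_comm, mul_eq_zero, Polynomial.C_eq_zero] at hder
        rw [eval_eq_zero_of_aeval_line_eq_zero q w (hder.resolve_left hw2), zero_mul]
      · -- `w₀ = 0 ≠ w₁`: use `R(f ∘ τ)`
        have hline' : ∀ t : K, eval ((q ∘ e) + t • fun i => (w 1)⁻¹ * (w ∘ e) i)
            (rename e f) = 0 := by
          intro t
          rw [eval_rename]
          convert hline (t * (w 1)⁻¹) using 3
          funext i
          simp only [Function.comp_apply, Pi.add_apply, Pi.smul_apply, smul_eq_mul, he]
          ring
        have hpoly' := aeval_line_eq_zero_of_forall_eval _ _ hline'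
        have hv0 : (fun i => (w 1)⁻¹ * (w ∘ e) i) 0 = 1 := by
          simp only [Function.comp_apply, he_def, Equiv.swap_apply_left]
          exact inv_mul_cancel₀ hw1
        have := eval_flecRes_eq_zero_of_line (rename e f) (q ∘ e) _ hv0 hpoly'
        rw [eval_rename, this, mul_zero, mul_zero]
    · -- `w₀ ≠ 0`: use `R(f)`
      have hpoly' := aeval_line_smul_eq_zero (K := K) q w (w 0)⁻¹ f hpoly
      have hv0 : (fun i => (w 0)⁻¹ * w i) 0 = 1 := inv_mul_cancel₀ hw0
      rw [eval_flecRes_eq_zero_of_line f q (fun i => (w 0)⁻¹ * w i) hv0 hpoly', zero_mul,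
        mul_zero]

/-- **A non-ruled surface of degree `d` contains at most `39 d²` lines** (the elementary
counterpart of [Kollar2015, Cor. 21 (1)], `d(11d−24)`): combine
`exists_vanishing_on_lines_of_not_generically_ruled` with Bézout for lines on two surfaces
(`card_lines_on_two_surfaces_le`, [Kollar2015, Prop. 14 (1)]).
[cite: Kollar2015, Corollary 21 (1) and Proposition 14 (1)] -/
theorem card_lines_le_of_not_generically_ruled [IsAlgClosed K] {f : MvPolynomial (Fin 3) K}
    (hf : Irreducible f) (hd : 3 ≤ f.totalDegree)
    (hchar : ringChar K = 0 ∨ f.totalDegree < ringChar K)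
    (hngr : ¬ ∃ h : MvPolynomial (Fin 3) K, ¬ f ∣ h ∧ ∀ p : Fin 3 → K, eval p f = 0 →
      eval p h ≠ 0 → ∃ ℓ : AffineSubspace K (Fin 3 → K), Module.finrank K ℓ.direction = 1 ∧
        p ∈ ℓ ∧ ∀ q ∈ ℓ, eval q f = 0)
    (Λ : Finset (AffineSubspace K (Fin 3 → K))) (hΛ1 : ∀ ℓ ∈ Λ, Module.finrank K ℓ.direction = 1)
    (hΛf : ∀ ℓ ∈ Λ, ∀ z ∈ ℓ, eval z f = 0) :
    Λ.card ≤ f.totalDegree * (39 * f.totalDegree) := by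
  haveI : Infinite K := IsAlgClosed.instInfinite
  obtain ⟨g, hfg, hdeg, hvan⟩ :=
    exists_vanishing_on_lines_of_not_generically_ruled hf hd hchar hngr
  have hrel : IsRelPrime f g := hf.isRelPrime_iff_not_dvd.2 hfg
  exact (card_lines_on_two_surfaces_le hrel Λ hΛ1 hΛf (fun ℓ hℓ z hz =>
    hvan ℓ (hΛ1 ℓ hℓ) (hΛf ℓ hℓ) z hz)).trans (Nat.mul_le_mul_left _ hdeg)

end Assembly

end Literature.Combinatorics.Extremal
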